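/-
Copyright: the b2b-balaban cell (near-miss cell 7), T⁴-continuum fan-out; row NE7b S4c (carrier debt F-ne7bp1g22-1(c) of
the COUNT route), part 3a, seat `t4-ne7b-formalise-leaf-02`.  Released under the licence of the surrounding project.
-/
import Summits.QuantumFields.BalabanUV.T4Continuum.Support.HistoryBankingLEInduction
import Summits.QuantumFields.BalabanUV.T4Continuum.Support.LateMergersCount

/-!
# Row NE7b S4c, part 3a: the tree-shape seam and the branching-gas exit WITHOUT the renewal-at-reach clause

Summits-side support leaf of the T⁴-continuum cell (rung (B)+1 on a FINITE torus only; NOT infinite volume, NOT the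
mass gap, NOT the Clay statement; NOT a proof of the spine estimate NE7b).  Row NE7b, route «COUNT», claim-table row
S4c (owner's ruling R-OWNER-22-6: «the TH exit re-derived over `ConsistentTLE`»).  [folklore] bookkeeping over the
lineage's OWN typed carrier; nothing is quoted from print, nothing printed is asserted, NO definition in this file, no
`[cite:]` tag.

WHY.  The NE7b assembly targets `CountThresholdExit.relWeightBound_lateMergers_of_irThreshold` at `D = 0`, whose
labelling binder asks a `ConsistentT` genealogy (renewal AT the booked reach).  Parts 1–2 (`HistoryBankingLE`,
`HistoryBankingLEInduction`) proved the banked price inequality for `ConsistentTLE` (renewal at `h + 1 ≤ reach`) with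
unchanged constants.  This part re-derives the SEAM and the GENERIC EXIT of `LateMergersCount` §9–§10 at `D = 0` over
`ConsistentTLE`: the only two uses of the admissibility predicate there are (i) the raw-factor bound — now
`HistoryBankingLEInduction.rawFactorLE_le_recordPrice` — and (ii) the span inequality
`(K + 1 − rootStep) + partnerAges ≤ Σ_{events} W`, whose ingredient `partnerAges ≤ windowSurplus` never used the
renewal clause (an early renewal only ADDS surplus).

WHAT.  §1 `partnerAges_le_windowSurplusTLE`, `spanTLE_add_partnerAges_le`, `wf_of_consistentTLE_freshT_chrono`
(`ConsistentTLE ∧ FreshT ∧ Chrono ⇒ Gen.WF`: `Chrono`'s renewal clause `rootStep < st e` supplies the one timing fact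
`ConsistentTLE` dropped).  §2 `rawFactorLE_of_pay` (parts 1–2 in the count's `rho`∕`eta` currency),
**`treeShape_of_labelBTLE`**, **`treeShape_of_labelTLE`** (= `LateMergersCount.treeShape_of_labelBTH`∕`_labelTH` at
`D = 0` with `ConsistentTH` ↦ `ConsistentTLE`, `FreshT` ↦ `Gen.WF`, and the abstract `Banking` instance replaced by the
raw-factor bound it was used for).  §3 **`exists_relWeightBound_of_rawFactorLE`** (=
`LateMergersCount.exists_relWeightBound_of_bankingTH` at `D = 0`, same conclusion
`∃ K₁ ≥ K₀, RelWeightBound … (𝟙·Cn·recordsBudget (Δ·ρ̄) …)`).  Part 3b (`HistoryExitLE`) names the infrared threshold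
and discharges the raw-factor bound from the typed flow; part 3c (`HistoryCanonLE`) gives `canonFam` membership.

HONEST.  Re-derivation of OUR seam with one clause of OUR predicate relaxed; NE7b NOT proved; spine 0/9.  HONEST
DEPENDENCY (cell): continuum YM on T⁴ ⇐ BetaPertH ∧ nine spine estimates (0/9 proved); BetaPertH ⇐ (D1) ∧ (D4) ∧
CAP+tail.  This file changes none of it.
-/

open Finset
open Literature.MathematicalPhysics.QuantumFieldTheory.Balaban1983to89
open T4PersistenceDictionary T4PersistentHistoryCount T4BankedInduction T4PrintedShapeBanking
open T4WeightBudget T4GlobalDenominator T4LiveClassFibration T4LiveStructureGas T4LiveGasToTerms T4RecordPriceSeam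
open T4PartnerMultiplicity T4BranchingRecordsGas T4TaggedShapeBanking T4CanonicalMenus T4CountHorizon
open Summit.QuantumFields.BalabanUV.T4Continuum.LateMergers
open Summit.QuantumFields.BalabanUV.T4Continuum.HistoryBankingLE
open Summit.QuantumFields.BalabanUV.T4Continuum.HistoryBankingLEInduction

namespace Summit.QuantumFields.BalabanUV.T4Continuum.HistoryTreeShapeLE

noncomputable section

/-! ## §1 The span inequality and well-formedness under `ConsistentTLE` -/

section Span

variable {ε : Type*} {sh : ε → PEv} {C : T4PrintedShapeBanking.Consts} {K : ℕ} {R : ℕ → ℕ}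

/-- **PARTNER AGES ≤ WINDOW SURPLUS** under `ConsistentTLE` (= `T4TaggedShapeBanking.partnerAges_le_windowSurplusT`;
the renewal case uses only the inductive hypothesis — an early renewal adds surplus). [folklore] -/
theorem partnerAges_le_windowSurplusTLE :
    ∀ {G : Gen ε}, ConsistentTLE sh C K R G → partnerAges (PEv.step ∘ sh) G ≤ windowSurplus (dictWT sh R C.n₁) G
  | Gen.born b j, _ => by simp
  | Gen.renew G e h, hc => by
      simp only [ConsistentTLE] at hc
      have ih := partnerAges_le_windowSurplusTLE hc.1
      simp only [partnerAges_renew, windowSurplus_renew]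
      omega
  | Gen.merge X Y e, hc => by
      simp only [ConsistentTLE] at hc
      obtain ⟨hX, hY, -, h1, h2, h3, h4, -⟩ := hc
      have ihX := partnerAges_le_windowSurplusTLE hX
      have ihY := partnerAges_le_windowSurplusTLE hY
      simp only [partnerAges_merge, windowSurplus_merge, Function.comp_apply]
      omega

variable [DecidableEq ε]

/-- **PENDING ⇒ SPAN + PARTNER AGES ≤ WINDOWS** under `ConsistentTLE` + well-formedness. [folklore] -/
theorem spanTLE_add_partnerAges_le {G : Gen ε} (hc : ConsistentTLE sh C K R G) (hW : G.WF (dictWT sh R C.n₁))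
    {N : ℕ} (hN : N < G.reach (dictWT sh R C.n₁)) :
    (N + 1 - G.rootStep) + partnerAges (PEv.step ∘ sh) G ≤ ∑ e ∈ G.events, dictWT sh R C.n₁ e := by
  have h1 := span_add_windowSurplus_le (dictWT sh R C.n₁) hW hN
  have h2 := partnerAges_le_windowSurplusTLE hc
  omega

/-- **`ConsistentTLE ∧ FreshT ∧ Chrono ⇒ Gen.WF`**: the one timing fact `ConsistentTLE` no longer carries — a renewal
happens after the line's root birth — is `Chrono`'s renewal clause `rootStep < st e = h + 1`; the rest (`h < reach`,
overlapping partner lives) is in `ConsistentTLE`, distinctness is `FreshT`. [folklore] -/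
theorem wf_of_consistentTLE_freshT_chrono :
    ∀ {G : Gen ε}, ConsistentTLE sh C K R G → FreshT G → Chrono (PEv.step ∘ sh) G → G.WF (dictWT sh R C.n₁)
  | Gen.born _ _, _, _, _ => trivial
  | Gen.renew G e h, hc, hf, hch => by
      simp only [ConsistentTLE] at hc
      obtain ⟨hG, -, hs, hr, -⟩ := hc
      simp only [FreshT] at hf
      obtain ⟨hchG, hlt, -⟩ := hch
      simp only [Function.comp_apply, hs] at hlt
      exact ⟨wf_of_consistentTLE_freshT_chrono hG hf.1 hchG, hf.2, by omega, by omega⟩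
  | Gen.merge X Y e, hc, hf, hch => by
      simp only [ConsistentTLE] at hc
      obtain ⟨hX, hY, -, hx, hx', hy, hy', -⟩ := hc
      simp only [FreshT] at hf
      obtain ⟨hfX, hfY, heX, heY, hd⟩ := hf
      obtain ⟨hchX, hchY, -⟩ := hch
      exact ⟨wf_of_consistentTLE_freshT_chrono hX hfX hchX, wf_of_consistentTLE_freshT_chrono hY hfY hchY, heX, heY,
        hd, by omega, by omega⟩

end Span

/-! ## §2 The seam, one genealogy and one branching slot, under `ConsistentTLE` -/

section Seam

variable {ε : Type*} [DecidableEq ε] {sh : ε → PEv} {C : T4PrintedShapeBanking.Consts} {K L : ℕ} {R : ℕ → ℕ}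
  {g : ℕ → ℝ} {β' β₀ : ℝ}

/-- **THE RAW-FACTOR BOUND IN THE COUNT'S CURRENCY** (`rho`, `eta`): parts 1–2 read through `rho_eq`∕`eta_eq`.
[folklore] -/
theorem rawFactorLE_of_pay (hC : C.Valid) (h29 : B14FlowStep.FlowIneq29 R g L β' β₀ K) (hL : 1 ≤ L)
    (hR1 : ∀ s, s ≤ K → 1 ≤ R s)
    (Hb : ∀ s, s ≤ K → ∀ d' : ℕ,
      (C.Eb + C.μ + (3 * C.E₂ * (L : ℝ) ^ C.q' + C.E₃ * (L : ℝ) ^ C.q' + 3 * C.κ₁) * (R s : ℝ) ^ (C.q' + 1)) *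
          ((d' : ℝ) + 1) + 2 * p0Profile C.A₀ C.p₀ (g s) ≤
        C.a * (p0Profile C.A₀ C.p₀ (g s)) ^ 2 * ((d' : ℝ) + 1) + 2 * p0Profile C.A₀ C.p₀ (g s))
    (Hr : ∀ h, h + 1 ≤ K →
      2 * C.E₂ * (L : ℝ) ^ C.q' * (R (h + 1) : ℝ) ^ (C.q' + 1) + (C.κ₁ * ((R (h + 1) : ℝ) + 1) + C.E₀) ≤
        p0Profile C.A₀ C.p₀ (g h))
    (Hm : ∀ m s, m ≤ s → s ≤ K →
      ((1 + C.n₁) * C.E₂ * (L : ℝ) ^ C.q' + C.dC * C.E₃ * (L : ℝ) ^ C.q') * (R s : ℝ) ^ (C.q' + 1) +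
          (C.κ₁ * ((C.n₁ : ℝ) + R s) + C.E₀) ≤ 2 * p0Profile C.A₀ C.p₀ (g m))
    {G : Gen ε} (hc : ConsistentTLE sh C K R G) (hf : FreshT G) :
    Real.exp (-credits (credit C g ∘ sh) G) * Real.exp (lifeCost (dictWT sh R C.n₁) (costT sh C K R) G) ≤
      (rho C g ∘ sh) G.root * Real.exp (-(C.κ₁ * ((dictWT sh R C.n₁ G.root : ℕ) : ℝ))) *
        ∏ e ∈ G.events.erase G.root,
          (Real.exp (-(C.κ₁ * ((dictWT sh R C.n₁ e : ℕ) : ℝ))) * (eta C ∘ sh) e) := by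
  have hp := rawFactorLE_le_recordPrice hC h29 hL hR1 Hb Hr Hm hc hf
  simpa only [Function.comp_apply, rho_eq, eta_eq] using hp

/-- **THE SEAM, ONE TAGGED GENEALOGY, NO RENEWAL-AT-REACH CLAUSE** — `LateMergersCount.treeShape_of_labelBTH` at
`D = 0` with `ConsistentTH` ↦ `ConsistentTLE`, `FreshT` ↦ `Gen.WF`, and the `Banking` instance replaced by the
raw-factor bound `hraw` it served: a price `y ≤ 0` or `≤ Δ·Λ′^{partnerAges}·e^{−credits}·e^{+lifeCost}` of a
`ConsistentTLE`, well-formed genealogy pending at `K` obeys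
`y ≤ e^{−κ₁ (K + 1 − rootStep)}·treeWt (rhoH Δ C g ∘ sh) (eta C ∘ sh) (Λ′e^{−κ₁}) (PEv.step ∘ sh) G`. [folklore] -/
theorem treeShape_of_labelBTLE (hκ : 0 ≤ C.κ₁)
    (hraw : ∀ G : Gen ε, ConsistentTLE sh C K R G → FreshT G →
      Real.exp (-credits (credit C g ∘ sh) G) * Real.exp (lifeCost (dictWT sh R C.n₁) (costT sh C K R) G) ≤
        (rho C g ∘ sh) G.root * Real.exp (-(C.κ₁ * ((dictWT sh R C.n₁ G.root : ℕ) : ℝ))) *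
          ∏ e ∈ G.events.erase G.root,
            (Real.exp (-(C.κ₁ * ((dictWT sh R C.n₁ e : ℕ) : ℝ))) * (eta C ∘ sh) e))
    {Λ' Δ : ℝ} (hΛ0 : 0 ≤ Λ') (hΔ : 1 ≤ Δ) {y : ℝ} {G : Gen ε}
    (hlab : y ≤ 0 ∨ (ConsistentTLE sh C K R G ∧ G.WF (dictWT sh R C.n₁) ∧ K < G.reach (dictWT sh R C.n₁) ∧
      y ≤ Δ * (Λ' ^ partnerAges (PEv.step ∘ sh) G *
        (Real.exp (-credits (credit C g ∘ sh) G) *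
          Real.exp (lifeCost (dictWT sh R C.n₁) (costT sh C K R) G))))) :
    y ≤ Real.exp (-(C.κ₁ * ((K + 1 - G.rootStep : ℕ) : ℝ))) *
      treeWt (rhoH Δ C g ∘ sh) (eta C ∘ sh) (Λ' * Real.exp (-C.κ₁)) (PEv.step ∘ sh) G := by
  have hΔ0 : 0 ≤ Δ := zero_le_one.trans hΔ
  rcases hlab with h | ⟨hc, hW, hK, hy⟩
  · exact h.trans (mul_nonneg (Real.exp_pos _).le (treeWt_nonneg (fun b => rhoH_nonneg hΔ0 C g (sh b))
      (fun e => (eta_pos C (sh e)).le) (mul_nonneg hΛ0 (Real.exp_pos _).le) (PEv.step ∘ sh) G))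
  · have hr := hraw G hc (FreshT.of_wf _ hW)
    have hy' : y ≤ Λ' ^ partnerAges (PEv.step ∘ sh) G * ((rhoH Δ C g ∘ sh) G.root *
        Real.exp (-(C.κ₁ * ((dictWT sh R C.n₁ G.root : ℕ) : ℝ))) *
        ∏ e ∈ G.events.erase G.root,
          (Real.exp (-(C.κ₁ * ((dictWT sh R C.n₁ e : ℕ) : ℝ))) * (eta C ∘ sh) e)) := by
      calc y ≤ Δ * (Λ' ^ partnerAges (PEv.step ∘ sh) G *
            (Real.exp (-credits (credit C g ∘ sh) G) *
              Real.exp (lifeCost (dictWT sh R C.n₁) (costT sh C K R) G))) := hy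
        _ ≤ Δ * (Λ' ^ partnerAges (PEv.step ∘ sh) G * ((rho C g ∘ sh) G.root *
            Real.exp (-(C.κ₁ * ((dictWT sh R C.n₁ G.root : ℕ) : ℝ))) *
            ∏ e ∈ G.events.erase G.root,
              (Real.exp (-(C.κ₁ * ((dictWT sh R C.n₁ e : ℕ) : ℝ))) * (eta C ∘ sh) e))) :=
          mul_le_mul_of_nonneg_left (mul_le_mul_of_nonneg_left hr (pow_nonneg hΛ0 _)) hΔ0
        _ = _ := by simp only [Function.comp_apply, rhoH_apply]; ring
    exact treeShape_of_spanLE (ρ := rhoH Δ C g ∘ sh) (η := eta C ∘ sh) (st := PEv.step ∘ sh)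
      (W := dictWT sh R C.n₁) hκ hΛ0 hW (rhoH_nonneg hΔ0 C g (sh G.root)) (fun e => eta_pos C (sh e))
      (spanTLE_add_partnerAges_le hc hW hK) hy'

/-- **THE SEAM, ONE BRANCHING SLOT, NO RENEWAL-AT-REACH CLAUSE** (= `LateMergersCount.treeShape_of_labelTH` at `D = 0`,
`ConsistentTLE`∕`Gen.WF` for `ConsistentTH`∕`FreshT`): the price at the branching record `G` (a term over SHAPES) is
`≤ 0` or at most `Δ·Λ′^{partnerAges G̃}` × the raw factor of SOME `ConsistentTLE`, well-formed tagged genealogy `G̃`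
pending at `K` with `relabel (shape ∘ sh) G̃ = G`; then
`y ≤ e^{−κ₁ (K + 1 − rootStep G)}·treeWt (rhoH Δ C g) (eta C) (Λ′e^{−κ₁}) PEv.step G`. [folklore] -/
theorem treeShape_of_labelTLE (hκ : 0 ≤ C.κ₁)
    (hraw : ∀ G : Gen ε, ConsistentTLE sh C K R G → FreshT G →
      Real.exp (-credits (credit C g ∘ sh) G) * Real.exp (lifeCost (dictWT sh R C.n₁) (costT sh C K R) G) ≤
        (rho C g ∘ sh) G.root * Real.exp (-(C.κ₁ * ((dictWT sh R C.n₁ G.root : ℕ) : ℝ))) *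
          ∏ e ∈ G.events.erase G.root,
            (Real.exp (-(C.κ₁ * ((dictWT sh R C.n₁ e : ℕ) : ℝ))) * (eta C ∘ sh) e))
    {Λ' Δ : ℝ} (hΛ0 : 0 ≤ Λ') (hΔ : 1 ≤ Δ) {y : ℝ} {G : Gen PEv}
    (hlabT : y ≤ 0 ∨ ∃ G' : Gen ε, ConsistentTLE sh C K R G' ∧ G'.WF (dictWT sh R C.n₁) ∧
      K < G'.reach (dictWT sh R C.n₁) ∧ relabel (shape ∘ sh) G' = G ∧
      y ≤ Δ * (Λ' ^ partnerAges (PEv.step ∘ sh) G' *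
        (Real.exp (-credits (credit C g ∘ sh) G') *
          Real.exp (lifeCost (dictWT sh R C.n₁) (costT sh C K R) G')))) :
    y ≤ Real.exp (-(C.κ₁ * ((K + 1 - G.rootStep : ℕ) : ℝ))) *
      treeWt (rhoH Δ C g) (eta C) (Λ' * Real.exp (-C.κ₁)) PEv.step G := by
  have hΔ0 : 0 ≤ Δ := zero_le_one.trans hΔ
  rcases hlabT with h | ⟨G', hc, hW, hK, hG, hy⟩
  · exact h.trans (mul_nonneg (Real.exp_pos _).le (treeWt_nonneg (fun b => rhoH_nonneg hΔ0 C g b)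
      (fun e => (eta_pos C e).le) (mul_nonneg hΛ0 (Real.exp_pos _).le) PEv.step G))
  · have h := treeShape_of_labelBTLE hκ hraw hΛ0 hΔ (Or.inr ⟨hc, hW, hK, hy⟩)
    rw [← hG, rootStep_relabel, treeWt_relabel_shapeH]
    exact h

end Seam

/-! ## §3 The generic exit over a family of runs, no renewal-at-reach clause -/

section Exit

variable {ε γ κ ι : Type*} [DecidableEq ε] [DecidableEq γ] [DecidableEq κ] {l₀ : ℝ} {K₀ : ℕ} {π : ℕ → ι → κ}
  {T : ℕ → Finset ι} {A A' : ℕ → ℝ → ι → ℝ} {Bad' : ℕ → ℝ → Finset κ} {dead dead' : ℕ → ℝ → ι → ℝ}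
  {F Rf F' Rf' : ℕ → κ → ℝ} {nlow nup mlow mup : ℕ → ℝ → ℝ} {Cn : ℝ}

/-- **RAW-FACTOR BOUND FOR `ConsistentTLE` GENEALOGIES + PRICES LABELLED BY `ConsistentTLE`, WELL-FORMED, PENDING
GENEALOGIES + THE BRANCHING RECORDS GAS ⇒ THE WEIGHT SLOT.**  `LateMergersCount.exists_relWeightBound_of_bankingTH` at
`D = 0` VERBATIM except: the per-cutoff `Banking (ConsistentTH …)` binder is replaced by the per-cutoff raw-factor bound
for `ConsistentTLE ∧ FreshT` genealogies (supplied by `HistoryExitLE` from the typed flow), and the labelling binder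
asks `ConsistentTLE … G′ ∧ G′.WF (dictWT …)`; SAME conclusion with budget `𝟙·Cn·recordsBudget (Δ·ρ̄) κ₁ V Λ η̄₊ j⋆`.
[folklore] -/
theorem exists_relWeightBound_of_rawFactorLE (sh : ε → PEv) {C : T4PrintedShapeBanking.Consts} (hκ : 0 ≤ C.κ₁)
    (R : ℕ → ℕ → ℕ) (g : ℕ → ℕ → ℝ)
    (hraw : ∀ K, K₀ ≤ K → ∀ G : Gen ε, ConsistentTLE sh C K (R K) G → FreshT G →
      Real.exp (-credits (credit C (g K) ∘ sh) G) *
          Real.exp (lifeCost (dictWT sh (R K) C.n₁) (costT sh C K (R K)) G) ≤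
        (rho C (g K) ∘ sh) G.root * Real.exp (-(C.κ₁ * ((dictWT sh (R K) C.n₁ G.root : ℕ) : ℝ))) *
          ∏ e ∈ G.events.erase G.root,
            (Real.exp (-(C.κ₁ * ((dictWT sh (R K) C.n₁ e : ℕ) : ℝ))) * (eta C ∘ sh) e))
    (Cell : ℕ → ℕ → Finset γ) {V Λ : ℝ} (hV : 0 ≤ V) (hΛ : 0 < Λ)
    (hcell : ∀ K a, ((Cell K a).card : ℝ) ≤ V * Λ ^ a)
    (Lren Lmer Lpart Lroot : ℕ → ℕ → Finset PEv) (Ncap : ℕ → ℕ)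
    (hst : ∀ K t, ∀ e ∈ Lmer K t, PEv.step e = t) {ρbar a μ ν ηplus : ℝ}
    (hρbar : ∀ K j, ∑ b ∈ Lroot K j, rho C (g K) b ≤ ρbar) (ha : ∀ K t, ∑ e ∈ Lren K t, eta C e ≤ a)
    (hμ : ∀ K t, ∑ e ∈ Lmer K t, eta C e ≤ μ) (hν : ∀ K s, ∑ b ∈ Lpart K s, eta C b ≤ ν) (hηplus : 0 ≤ ηplus)
    (hr : Λ * Real.exp (ηplus - C.κ₁) < 1) {Λ' : ℝ} (hΛ0 : 0 ≤ Λ')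
    (h1 : Λ' * Real.exp (-C.κ₁) * Real.exp ηplus < 1)
    (hx : (a + μ * ν * (Λ' * Real.exp (-C.κ₁) / (1 - Λ' * Real.exp (-C.κ₁) * Real.exp ηplus))) * Real.exp ηplus ≤
      Real.exp ηplus - 1)
    (jstar : ℕ → ℕ) (hj : ∀ K, jstar K ≤ K) {c : ℝ} (hc : 0 < c)
    (hfrac : ∀ K : ℕ, c * K ≤ ((K - jstar K : ℕ) : ℝ)) {Δ : ℝ} (hΔ : 1 ≤ Δ)
    (y : ℕ → ℕ → γ → Gen PEv → ℝ)
    (hy0 : ∀ K, ∀ j ≤ K, ∀ z ∈ Cell K (K - j), ∀ G ∈ runFam Lren Lmer Lpart Lroot Ncap K j, 0 ≤ y K j z G)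
    (hlabTLE : ∀ K, K₀ ≤ K → ∀ j ≤ K, ∀ z ∈ Cell K (K - j), ∀ G ∈ runFam Lren Lmer Lpart Lroot Ncap K j,
      y K j z G ≤ 0 ∨ ∃ G' : Gen ε, ConsistentTLE sh C K (R K) G' ∧ G'.WF (dictWT sh (R K) C.n₁) ∧
        K < G'.reach (dictWT sh (R K) C.n₁) ∧ relabel (shape ∘ sh) G' = G ∧
        y K j z G ≤ Δ * (Λ' ^ partnerAges (PEv.step ∘ sh) G' * (Real.exp (-credits (credit C (g K) ∘ sh) G') *
          Real.exp (lifeCost (dictWT sh (R K) C.n₁) (costT sh C K (R K)) G'))))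
    (str : ℕ → κ → Finset (BSlot γ PEv))
    (hinj : ∀ K t, |t| ≤ l₀ → K₀ ≤ K → Set.InjOn (str K) (Bad' K t))
    (hstr : ∀ K t, |t| ≤ l₀ → K₀ ≤ K → ∀ c ∈ Bad' K t,
      str K c ⊆ bliveSlots Cell (runFam Lren Lmer Lpart Lroot Ncap) K ∧
        ∃ o ∈ boldSlots Cell (runFam Lren Lmer Lpart Lroot Ncap) jstar K, o ∈ str K c)
    (hA : Regeneration l₀ π T A Bad' dead F Rf nlow nup Cn K₀)
    (hA' : Regeneration l₀ π T A' Bad' dead' F' Rf' mlow mup Cn K₀)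
    (hF : ∀ K t, |t| ≤ l₀ → K₀ ≤ K → ∀ c ∈ Bad' K t, F K c * Rf K c ≤ famWeight (bslotPrice (y K)) (str K c))
    (hF' : ∀ K t, |t| ≤ l₀ → K₀ ≤ K → ∀ c ∈ Bad' K t, F' K c * Rf' K c ≤ famWeight (bslotPrice (y K)) (str K c))
    (hCn : 0 ≤ Cn) :
    ∃ K₁, K₀ ≤ K₁ ∧ RelWeightBound l₀ T A A' (fun K t => if K₁ ≤ K then badOfClass π T Bad' K t else ∅)
      (Set.indicator {K | K₁ ≤ K} (fun K => Cn * recordsBudget (Δ * ρbar) C.κ₁ V Λ ηplus jstar K)) := by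
  have hΔ0 : 0 ≤ Δ := zero_le_one.trans hΔ
  exact exists_relWeightBound_of_regeneration_branchingGasRun Cell hV hΛ hcell Lren Lmer Lpart Lroot Ncap PEv.step hst
    (fun K => rhoH Δ C (g K)) (fun _ => eta C)
    (fun K b => rhoH_nonneg hΔ0 C (g K) b) (fun _ e => (eta_pos C e).le)
    (fun K j => by
      rw [sum_rhoH]
      exact mul_le_mul_of_nonneg_left (hρbar K j) hΔ0)
    ha hμ hν (mul_nonneg hΛ0 (Real.exp_pos _).le) hηplus h1 hx hr jstar hj hc hfrac y hy0
    (fun K hK j hjK z hz G hG => by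
      have h := treeShape_of_labelTLE hκ (hraw K hK) hΛ0 hΔ (hlabTLE K hK j hjK z hz G hG)
      rwa [rootStep_of_mem_fam (Lren := Lren K) (Lmer := Lmer K) (Lpart := Lpart K) (Ncap K) (Lroot K j) j K G hG]
        at h)
    str hinj hstr hA hA' hF hF' hCn

end Exit

end

end Summit.QuantumFields.BalabanUV.T4Continuum.HistoryTreeShapeLE
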